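import Mathlib

/-!
# Trigonometric moment uniqueness on at most `2N` circle points (fake seat 5, gen 4; pure trigonometry)

Mechanism / rigidity campaign `pub-rhpf` (FAKE SEAT 5); **no RH claims** — this file is Mathlib-only and is the
engine of THEOREM F5-INJ (`PfPersistenceF5WithinRangeRigidity.lean`: one window determines the within-range
weights).

`trigMoment_eq_zero`: if `ω` is injective on a finite set `s` with values in `(0, 2π)`, `c > 0` on `s`, `#s ≤ N`,
and the moment sums `Σ_{q∈s} δ_q sin(m ω_q)` and `Σ_{q∈s} δ_q c_q cos(m ω_q)` vanish for all `m ≤ N`, then `δ = 0`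
on `s`.  Proof (Laurent–Lagrange evaluation, `laurent_sum_eq_zero`): the vanishing moments kill
`Σ_q e_q (z̄_q^N P(z_q) ± z_q^N P(z̄_q))` for every polynomial `P` of degree `≤ 2N` (`z_q = e^{iω_q}`,
`z̄_q = z_q^{-1}`); the Lagrange polynomial of the `≤ 2N` nodes `{z_q} ∪ {z̄_q}` isolates `q₀` together with its at
most one antipodal partner `ω_{q₁} + ω_{q₀} = 2π` (`exp_neg_mul_I_eq_iff`), where the two systems give
`δ_{q₀} = δ_{q₁}` and `δ_{q₀} c_{q₀} + δ_{q₁} c_{q₁} = 0`, hence `δ_{q₀} = 0` by `c > 0`.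

References: uniqueness of a finitely-atomic measure on the circle from `2N+1` Fourier coefficients (nonsingular
Vandermonde; Prony 1795) — folklore.  Labels: every `theorem` is PROVED here; nothing is DATA.
-/

set_option linter.dupNamespace false

noncomputable section

open Real Finset Polynomial Complex

namespace Summit.RiemannHypothesis.RiemannHypothesis.Theorems.PfPersistence

/-! ## §1 Trigonometric moment uniqueness on at most `2N` circle points -/

section Trig

variable {ι : Type*}

/-- `z̄^{(i+j)} z^{i} = z̄^{j}` and `z^{(i+j)} z̄^{i} = z^{j}` when `z z̄ = 1`. [folklore] -/
theorem pow_add_mul_pow_of_mul_eq_one {z zb : ℂ} (h : z * zb = 1) (i j : ℕ) :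
    zb ^ (i + j) * z ^ i = zb ^ j ∧ z ^ (i + j) * zb ^ i = z ^ j := by
  have h' : (z * zb) ^ i = 1 := by rw [h, one_pow]
  rw [mul_pow] at h'
  refine ⟨?_, ?_⟩
  · calc zb ^ (i + j) * z ^ i = zb ^ j * (z ^ i * zb ^ i) := by rw [pow_add]; ring
      _ = zb ^ j := by rw [h', mul_one]
  · calc z ^ (i + j) * zb ^ i = z ^ j * (z ^ i * zb ^ i) := by rw [pow_add]; ring
      _ = z ^ j := by rw [h', mul_one]

/-- **Laurent step.** If the signed two-sided power sums `Σ_q e_q (z_q^m + σ z̄_q^m)` and `Σ_q e_q (z̄_q^m + σ z_q^m)`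
vanish for `m ≤ N` (`z_q z̄_q = 1`), then `Σ_q e_q (z̄_q^N P(z_q) + σ z_q^N P(z̄_q)) = 0` for every polynomial `P`
of degree `≤ 2N`. [folklore] -/
theorem laurent_sum_eq_zero (s : Finset ι) (e z zb : ι → ℂ) (σ : ℂ) (N : ℕ)
    (hzz : ∀ q ∈ s, z q * zb q = 1)
    (hA : ∀ m : ℕ, m ≤ N → ∑ q ∈ s, e q * (z q ^ m + σ * zb q ^ m) = 0)
    (hB : ∀ m : ℕ, m ≤ N → ∑ q ∈ s, e q * (zb q ^ m + σ * z q ^ m) = 0)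
    (P : ℂ[X]) (hP : P.natDegree ≤ 2 * N) :
    ∑ q ∈ s, e q * (zb q ^ N * P.eval (z q) + σ * (z q ^ N * P.eval (zb q))) = 0 := by
  -- the two-sided monomial sums vanish for every exponent `i ≤ 2N`
  have hmono : ∀ i : ℕ, i ≤ 2 * N →
      ∑ q ∈ s, e q * (zb q ^ N * z q ^ i + σ * (z q ^ N * zb q ^ i)) = 0 := by
    intro i hi
    by_cases hle : i ≤ N
    · obtain ⟨j, hj⟩ : ∃ j, N = i + j := ⟨N - i, by omega⟩
      have hjN : j ≤ N := by omega
      rw [← hB j hjN]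
      refine Finset.sum_congr rfl fun q hq => ?_
      obtain ⟨h1, h2⟩ := pow_add_mul_pow_of_mul_eq_one (hzz q hq) i j
      rw [hj, h1, h2]
    · obtain ⟨j, hj⟩ : ∃ j, i = N + j := ⟨i - N, by omega⟩
      have hjN : j ≤ N := by omega
      rw [← hA j hjN]
      refine Finset.sum_congr rfl fun q hq => ?_
      obtain ⟨h1, h2⟩ := pow_add_mul_pow_of_mul_eq_one (hzz q hq) N j
      rw [hj]
      have e1 : zb q ^ N * z q ^ (N + j) = z q ^ j := by rw [mul_comm]; exact h2
      have e2 : z q ^ N * zb q ^ (N + j) = zb q ^ j := by rw [mul_comm]; exact h1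
      rw [e1, e2]
  -- expand `P` in monomials and swap the sums
  have hdeg : P.natDegree < 2 * N + 1 := by omega
  simp_rw [Polynomial.eval_eq_sum_range' hdeg, Finset.mul_sum, ← Finset.sum_add_distrib]
  have : ∀ q ∈ s, e q * ∑ i ∈ Finset.range (2 * N + 1),
      (zb q ^ N * (P.coeff i * z q ^ i) + σ * (z q ^ N * (P.coeff i * zb q ^ i)))
      = ∑ i ∈ Finset.range (2 * N + 1), P.coeff i * (e q * (zb q ^ N * z q ^ i + σ * (z q ^ N * zb q ^ i))) := by
    intro q _
    rw [Finset.mul_sum]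
    exact Finset.sum_congr rfl fun i _ => by ring
  rw [Finset.sum_congr rfl this, Finset.sum_comm]
  refine Finset.sum_eq_zero fun i hi => ?_
  rw [← Finset.mul_sum, hmono i (by simpa [Nat.lt_succ_iff] using Finset.mem_range.1 hi), mul_zero]


/-- `e^{iω} = e^{iω'}` with `ω, ω' ∈ (0, 2π)` forces `ω = ω'`. [folklore] -/
theorem eq_of_exp_mul_I_eq {x y : ℝ} (hx : 0 < x ∧ x < 2 * π) (hy : 0 < y ∧ y < 2 * π)
    (h : Complex.exp ((x : ℂ) * Complex.I) = Complex.exp ((y : ℂ) * Complex.I)) : x = y := by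
  obtain ⟨n, hn⟩ := Complex.exp_eq_exp_iff_exists_int.1 h
  have him := congrArg Complex.im hn
  simp at him
  -- `him : x = y + n * (2 * π)`
  have h2 : (0 : ℝ) < 2 * π := by positivity
  have hn1 : (n : ℝ) < 1 := by
    by_contra hcon; push Not at hcon; nlinarith
  have hn2 : (-1 : ℝ) < n := by
    by_contra hcon; push Not at hcon; nlinarith
  have hn0 : n = 0 := by
    have a : n < 1 := by exact_mod_cast hn1
    have b : -1 < n := by exact_mod_cast hn2
    omega
  rw [hn0] at him; simpa using him

/-- `e^{-iω} = e^{iω₀}` with `ω, ω₀ ∈ (0, 2π)` iff the two angles are antipodal partners `ω + ω₀ = 2π`. [folklore] -/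
theorem exp_neg_mul_I_eq_iff {x y : ℝ} (hx : 0 < x ∧ x < 2 * π) (hy : 0 < y ∧ y < 2 * π) :
    Complex.exp (-((x : ℂ) * Complex.I)) = Complex.exp ((y : ℂ) * Complex.I) ↔ x + y = 2 * π := by
  constructor
  · intro h
    obtain ⟨n, hn⟩ := Complex.exp_eq_exp_iff_exists_int.1 h
    have him := congrArg Complex.im hn
    simp at him
    -- `him : -x = y + n * (2 * π)`
    have h2 : (0 : ℝ) < 2 * π := by positivity
    have hn1 : (n : ℝ) < 0 := by
      by_contra hcon; push Not at hcon; nlinarith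
    have hn2 : (-2 : ℝ) < n := by
      by_contra hcon; push Not at hcon; nlinarith
    have hn0 : n = -1 := by
      have a : n < 0 := by exact_mod_cast hn1
      have b : -2 < n := by exact_mod_cast hn2
      omega
    rw [hn0] at him; push_cast at him; linarith
  · intro h
    have hx' : (x : ℂ) = 2 * π - y := by exact_mod_cast (eq_sub_of_add_eq h)
    refine Complex.exp_eq_exp_iff_exists_int.2 ⟨-1, ?_⟩
    rw [hx']; push_cast; ring

/-- **PROVED (trigonometric moment uniqueness).** `ω` injective on `s` with values in `(0, 2π)`, `c > 0` on `s`,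
`#s ≤ N`; if `Σ_{q∈s} δ_q sin(m ω_q) = 0` and `Σ_{q∈s} δ_q c_q cos(m ω_q) = 0` for all `m ≤ N`, then `δ = 0`
on `s`.  (Laurent–Lagrange evaluation at the `≤ 2N` nodes `e^{± iω_q}`; the antipodal partner `ω_q + ω_{q₀} = 2π`
is the only coupling and is resolved by `c > 0`.) [folklore] -/
theorem trigMoment_eq_zero (s : Finset ι) (ω δ c : ι → ℝ) (N : ℕ) (hinj : Set.InjOn ω s)
    (hω : ∀ q ∈ s, 0 < ω q ∧ ω q < 2 * π) (hc : ∀ q ∈ s, 0 < c q) (hcard : s.card ≤ N)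
    (hS : ∀ m : ℕ, m ≤ N → ∑ q ∈ s, δ q * Real.sin (m * ω q) = 0)
    (hC : ∀ m : ℕ, m ≤ N → ∑ q ∈ s, δ q * c q * Real.cos (m * ω q) = 0) :
    ∀ q ∈ s, δ q = 0 := by
  classical
  -- nodes
  set z : ι → ℂ := fun q => Complex.exp ((ω q : ℂ) * Complex.I) with hzdef
  set zb : ι → ℂ := fun q => Complex.exp (-((ω q : ℂ) * Complex.I)) with hzbdef
  have hzz : ∀ q ∈ s, z q * zb q = 1 := fun q _ => by
    simp only [hzdef, hzbdef, ← Complex.exp_add, add_neg_cancel, Complex.exp_zero]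
  have hzbne : ∀ q, zb q ≠ 0 := fun q => Complex.exp_ne_zero _
  -- power sums as trigonometric sums
  have hcos : ∀ (q : ι) (m : ℕ), z q ^ m + zb q ^ m = 2 * ((Real.cos (m * ω q) : ℝ) : ℂ) := by
    intro q m
    rw [Complex.ofReal_cos, Complex.two_cos]
    simp only [hzdef, hzbdef, ← Complex.exp_nat_mul]
    push_cast
    congr 1 <;> congr 1 <;> ring
  have hsin : ∀ (q : ι) (m : ℕ), z q ^ m - zb q ^ m = 2 * ((Real.sin (m * ω q) : ℝ) : ℂ) * Complex.I := by
    intro q m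
    rw [Complex.ofReal_sin]
    have h2 := Complex.two_sin ((m : ℂ) * (ω q : ℂ))
    simp only [hzdef, hzbdef, ← Complex.exp_nat_mul]
    push_cast
    rw [show (m : ℂ) * ((ω q : ℂ) * Complex.I) = (m : ℂ) * (ω q : ℂ) * Complex.I by ring,
      show (m : ℂ) * -((ω q : ℂ) * Complex.I) = -((m : ℂ) * (ω q : ℂ)) * Complex.I by ring]
    linear_combination (-Complex.I) * h2
      + (Complex.exp ((m : ℂ) * (ω q : ℂ) * Complex.I) - Complex.exp (-((m : ℂ) * (ω q : ℂ)) * Complex.I))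
        * Complex.I_sq
  -- the two vanishing systems, complexified: `e = δ c` with `σ = 1`, `d = δ` with `σ = -1`
  have hE : ∀ m : ℕ, m ≤ N → ∑ q ∈ s, ((δ q * c q : ℝ) : ℂ) * (z q ^ m + 1 * zb q ^ m) = 0 := by
    intro m hm
    have h := congrArg (fun r : ℝ => (2 * r : ℂ)) (hC m hm)
    simp only [mul_zero, Complex.ofReal_zero] at h
    rw [← h]; push_cast; rw [Finset.mul_sum]
    refine Finset.sum_congr rfl fun q _ => ?_
    rw [one_mul, hcos]; push_cast; ring
  have hE' : ∀ m : ℕ, m ≤ N → ∑ q ∈ s, ((δ q * c q : ℝ) : ℂ) * (zb q ^ m + 1 * z q ^ m) = 0 := by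
    intro m hm; rw [← hE m hm]; exact Finset.sum_congr rfl fun q _ => by ring
  have hD : ∀ m : ℕ, m ≤ N → ∑ q ∈ s, ((δ q : ℝ) : ℂ) * (z q ^ m + (-1) * zb q ^ m) = 0 := by
    intro m hm
    have h := congrArg (fun r : ℝ => (2 * r : ℂ) * Complex.I) (hS m hm)
    simp only [mul_zero, Complex.ofReal_zero, zero_mul] at h
    rw [← h]; push_cast; rw [Finset.mul_sum, Finset.sum_mul]
    refine Finset.sum_congr rfl fun q _ => ?_
    rw [show z q ^ m + (-1) * zb q ^ m = z q ^ m - zb q ^ m by ring, hsin]; push_cast; ring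
  have hD' : ∀ m : ℕ, m ≤ N → ∑ q ∈ s, ((δ q : ℝ) : ℂ) * (zb q ^ m + (-1) * z q ^ m) = 0 := by
    intro m hm
    have h := hD m hm
    rw [← neg_eq_zero, ← Finset.sum_neg_distrib] at h
    rw [← h]; exact Finset.sum_congr rfl fun q _ => by ring
  -- fix `q₀` and its Lagrange polynomial on the node set
  intro q₀ hq₀
  set P0 : Finset ℂ := s.image z ∪ s.image zb with hP0
  have hcardP : P0.card ≤ 2 * N :=
    (Finset.card_union_le _ _).trans
      ((Nat.add_le_add Finset.card_image_le Finset.card_image_le).trans (by omega))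
  have hz0 : z q₀ ∈ P0 := Finset.mem_union_left _ (Finset.mem_image_of_mem _ hq₀)
  have hzP : ∀ q ∈ s, z q ∈ P0 := fun q hq => Finset.mem_union_left _ (Finset.mem_image_of_mem _ hq)
  have hzbP : ∀ q ∈ s, zb q ∈ P0 := fun q hq => Finset.mem_union_right _ (Finset.mem_image_of_mem _ hq)
  set Lg : ℂ[X] := Lagrange.basis P0 id (z q₀) with hLg
  have hdeg : Lg.natDegree ≤ 2 * N := by
    rw [hLg, Lagrange.natDegree_basis (v := id) (Set.injOn_id _) hz0]; omega
  have hev_self : Lg.eval (z q₀) = 1 := by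
    have h := Lagrange.eval_basis_self (v := id) (Set.injOn_id _) hz0
    simpa using h
  have hev_ne : ∀ p ∈ P0, p ≠ z q₀ → Lg.eval p = 0 := by
    intro p hp hne
    have h := Lagrange.eval_basis_of_ne (v := id) (s := P0) (i := z q₀) (j := p) hne.symm hp
    simpa using h
  -- node coincidences
  have hz_iff : ∀ q ∈ s, (z q = z q₀ ↔ q = q₀) := by
    intro q hq
    refine ⟨fun h => hinj hq hq₀ (eq_of_exp_mul_I_eq (hω q hq) (hω q₀ hq₀) h), fun h => by rw [h]⟩
  have hzb_iff : ∀ q ∈ s, (zb q = z q₀ ↔ ω q + ω q₀ = 2 * π) := fun q hq =>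
    exp_neg_mul_I_eq_iff (hω q hq) (hω q₀ hq₀)
  have hevz : ∀ q ∈ s, Lg.eval (z q) = if q = q₀ then 1 else 0 := by
    intro q hq
    by_cases h : q = q₀
    · rw [if_pos h, h, hev_self]
    · rw [if_neg h]; exact hev_ne _ (hzP q hq) (fun h' => h ((hz_iff q hq).1 h'))
  have hevzb : ∀ q ∈ s, Lg.eval (zb q) = if ω q + ω q₀ = 2 * π then 1 else 0 := by
    intro q hq
    by_cases h : ω q + ω q₀ = 2 * π
    · rw [if_pos h, (hzb_iff q hq).2 h, hev_self]
    · rw [if_neg h]; exact hev_ne _ (hzbP q hq) (fun h' => h ((hzb_iff q hq).1 h'))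
  -- the partner set
  set T : Finset ι := s.filter (fun q => ω q + ω q₀ = 2 * π) with hT
  have hTz : ∀ q ∈ T, z q ^ N = zb q₀ ^ N := by
    intro q hq
    obtain ⟨hqs, hqω⟩ := Finset.mem_filter.1 hq
    have : z q = zb q₀ := by
      have h' : ω q₀ + ω q = 2 * π := by linarith
      exact ((exp_neg_mul_I_eq_iff (hω q₀ hq₀) (hω q hqs)).2 h').symm
    rw [this]
  have hTcard : ∀ a ∈ T, ∀ b ∈ T, a = b := by
    intro a ha b hb
    obtain ⟨has, haω⟩ := Finset.mem_filter.1 ha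
    obtain ⟨hbs, hbω⟩ := Finset.mem_filter.1 hb
    exact hinj has hbs (by linarith)
  -- evaluate both Laurent identities at `Lg`
  have hEv := laurent_sum_eq_zero s (fun q => ((δ q * c q : ℝ) : ℂ)) z zb 1 N hzz hE hE' Lg hdeg
  have hDv := laurent_sum_eq_zero s (fun q => ((δ q : ℝ) : ℂ)) z zb (-1) N hzz hD hD' Lg hdeg
  beta_reduce at hEv hDv
  -- collapse the sums: only `q₀` (first slot) and the partners `T` (second slot) survive
  have collapse : ∀ (f : ι → ℂ) (σ : ℂ),
      ∑ q ∈ s, f q * (zb q ^ N * Lg.eval (z q) + σ * (z q ^ N * Lg.eval (zb q)))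
        = (f q₀ + σ * ∑ q ∈ T, f q) * zb q₀ ^ N := by
    intro f σ
    have h1 : ∀ q ∈ s, f q * (zb q ^ N * Lg.eval (z q) + σ * (z q ^ N * Lg.eval (zb q)))
        = (if q = q₀ then f q * zb q ^ N else 0)
          + σ * (if ω q + ω q₀ = 2 * π then f q * z q ^ N else 0) := by
      intro q hq
      rw [hevz q hq, hevzb q hq]
      split_ifs <;> ring
    rw [Finset.sum_congr rfl h1, Finset.sum_add_distrib, Finset.sum_ite_eq' s q₀, if_pos hq₀,
      ← Finset.mul_sum, ← Finset.sum_filter]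
    have h2 : ∑ q ∈ T, f q * z q ^ N = (∑ q ∈ T, f q) * zb q₀ ^ N := by
      rw [Finset.sum_mul]; exact Finset.sum_congr rfl fun q hq => by rw [hTz q hq]
    rw [h2]; ring
  rw [collapse] at hEv hDv
  have hEv' : ((δ q₀ * c q₀ : ℝ) : ℂ) + 1 * ∑ q ∈ T, ((δ q * c q : ℝ) : ℂ) = 0 :=
    (mul_eq_zero.1 hEv).resolve_right (pow_ne_zero _ (hzbne q₀))
  have hDv' : ((δ q₀ : ℝ) : ℂ) + (-1) * ∑ q ∈ T, ((δ q : ℝ) : ℂ) = 0 :=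
    (mul_eq_zero.1 hDv).resolve_right (pow_ne_zero _ (hzbne q₀))
  -- back to `ℝ`
  have hEr : δ q₀ * c q₀ + ∑ q ∈ T, δ q * c q = 0 := by
    have h := hEv'; rw [one_mul] at h; exact_mod_cast h
  have hDr : δ q₀ - ∑ q ∈ T, δ q = 0 := by
    have h := hDv'; rw [neg_one_mul, ← sub_eq_add_neg] at h; exact_mod_cast h
  -- case analysis on the (at most one) partner
  rcases T.eq_empty_or_nonempty with hT0 | ⟨q₁, hq₁⟩
  · rw [hT0, Finset.sum_empty, sub_zero] at hDr; exact hDr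
  · have hT1 : T = {q₁} := Finset.eq_singleton_iff_unique_mem.2 ⟨hq₁, fun b hb => hTcard b hb q₁ hq₁⟩
    rw [hT1, Finset.sum_singleton] at hEr hDr
    have hq₁s : q₁ ∈ s := (Finset.mem_filter.1 hq₁).1
    have hδ : δ q₁ = δ q₀ := by linarith
    rw [hδ] at hEr
    have hpos : 0 < c q₀ + c q₁ := add_pos (hc q₀ hq₀) (hc q₁ hq₁s)
    have : δ q₀ * (c q₀ + c q₁) = 0 := by linear_combination hEr
    exact (mul_eq_zero.1 this).resolve_right (ne_of_gt hpos)

end Trig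

end Summit.RiemannHypothesis.RiemannHypothesis.Theorems.PfPersistence
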